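import Summits.BirchSwinnertonDyer.Rank1Residual.Additive.GordCycRankOneLambda
import Summits.BirchSwinnertonDyer.Rank1Residual.AdditivePotMult.PotMultDelbourgo2002Bridge
import HarnessLib

/-!
# The λ-certificate lever of `GordCycRankOneLambda.lean` — CLASS FORMS: (M) at EVERY odd prime
# (n1011-p16's `Delbourgo2002.mainTheorem_potMult`) and (G)-ordinary at `p ≥ 5` (A175)
# (cell `b2b-bsdres`, team n1011, seat p01, OWNERS row T-O7)

HONEST FRAMING (cell `b2b-bsdres`, run/shared/lean/b2b/bsd-rank1-residual/, verbatim in every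
file): prove what is provable now; shrink each hard class to its core with data; no claim beyond
stated classes. Research routes; census output = EVIDENCE / conjecture items, never a Literature
fact; RESIDUAL-MAP marks change only by signed lines. §I O7 stays OPEN; X3♯(M)/X4(M)/X3♯(G-ord)/
X4♯(G-ord) stay CONSTRUCTION-SHAPED; nothing is booked; no label changes. COVERAGE (stated first,
referee 1 proviso): the (M) forms hold at EVERY ODD `p` incl. `p = 3` (binder
`Delbourgo2002.mainTheorem_potMult`, every hypothesis discharged by p16's bridge `PotMult.delbourgo2002`);
the (G)-ordinary forms need `p ≥ 5` and `E` non-CM (A175 `Delbourgo2002.mainTheorem`); `p = 3` on the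
(G-ord, e = 2) cell is NOT covered (A175's TODO). The λ-certificate `CharLamLeAt W p (rank E(ℚ))` is an
explicit, certificate-shaped binder (intended discharge: Delbourgo 2002 (C) + `λ(L_p^{an}|_Δ) = rank`,
neither typed yet) — it REPLACES the Schneider rider, it is not a numerical discharge of it. Theorems
only; no definition, no named fact, no `_holds`.

## What (all inputs explicit binders)

* `PotMult.schneider_of_charLamLe` / `PotMult.finite_shaPrimary_of_charLamLe`: on (M), `p` odd, the
  λ-certificate gives `Reg_p(Dh) ≠ 0` for EVERY height datum with Delbourgo's (B)-clauses, and
  `#Ш(E/ℚ)[p^∞] < ∞` — from Delbourgo 2002 (A)+(B) alone (no GZK, any rank).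
* `PotMult.rank_add_le_padicVal_of_charLamLe`: `rank + 2·ord_p #tors ≤ ord_p #Ш[p^∞] + ord_p Reg_p(Dh) + ord_p ∏c_ℓ`
  for every such `Dh` (`ℓ = 1` on (M)).
* `PotMult.missingLowerBoundAt_of_charLamLe_of_regulatorCertificate`: + GZK, `r_an ≤ 1`, `#Ш_an = s`
  and the per-pair inequality `ord_p Reg_p(Dh) + ord_p s + ord_p ∏c_ℓ ≤ rank + 2·ord_p #tors` for the
  (B)-data ⟹ `Typed.MissingLowerBoundAt W p`; class wrappers `ClassX4M.…`, `ClassX3M.…` (reducible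
  `E[p]` allowed: the lower half needs no image hypothesis).
* `TypeGOrd` twins at `p ≥ 5`, non-CM, non-anomalous (A175).

References: [Delbourgo2002] Thm. (A), (B), (C) (p. 40), p. 39; [Washington1997] §7.1; [Miller2011LMS] Def. 1.1.
-/

noncomputable section

open scoped Classical NumberField

open WeierstrassCurve NumberField Literature.NumberTheory.EllipticCurves
  Literature.NumberTheory.EllipticCurves.Rank1Residual
  Literature.NumberTheory.EllipticCurves.Rank1Residual.Typed
  Literature.NumberTheory.EllipticCurves.Delbourgo2002
  IsDedekindDomain

namespace Summit.BirchSwinnertonDyer.Rank1Residual.AdditivePotMult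

open Additive

variable {W : WeierstrassCurve ℚ} [W.IsElliptic] [W.IsGloballyMinimal] {p : ℕ} [hp : Fact p.Prime]

/-! ### (M), every odd prime -/

/-- **(M): the λ-certificate gives Delbourgo's Schneider rider for EVERY (B)-datum** (`p` odd, any rank;
Delbourgo 2002 (A)+(B) [(M)] via p16's bridge). [cite: Delbourgo2002, Theorem (A), (B) (p. 40)] -/
theorem PotMult.schneider_of_charLamLe (hDelM : Delbourgo2002.mainTheorem_potMult) (hpm : PotMult W p)
    (hp2 : p ≠ 2) (hlam : CharLamLeAt W p W.mordellWeilRank) {Dh : PAdicHeightData W p}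
    (hB : LeadingTermClauses W p Dh) : SchneiderConjecture Dh :=
  (schneider_and_finite_of_charLamLe W p hB (hpm.delbourgo2002 hDelM hp2).1 hlam).1

/-- **(M): the λ-certificate gives `#Ш(E/ℚ)[p^∞] < ∞`** (`p` odd, ANY rank, no Gross–Zagier–Kolyvagin):
Delbourgo 2002 (A)+(B) [(M)] supply a (B)-datum, and clause 2 applies (`schneider_and_finite_of_charLamLe`).
[cite: Delbourgo2002, Theorem (A), (B) (p. 40)] -/
theorem PotMult.finite_shaPrimary_of_charLamLe (hDelM : Delbourgo2002.mainTheorem_potMult)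
    (hpm : PotMult W p) (hp2 : p ≠ 2) (hlam : CharLamLeAt W p W.mordellWeilRank) :
    Finite (AddCommGroup.primaryComponent W.sha p) := by
  obtain ⟨hA, Dh, hB⟩ := hpm.delbourgo2002 hDelM hp2
  exact (schneider_and_finite_of_charLamLe W p hB hA hlam).2

/-- **(M): the LOWER bound on `Ш[p^∞]` from ONE regulator valuation, for every (B)-datum** (`p` odd;
`ℓ = 1` on (M)): `rank + 2·ord_p #tors ≤ ord_p #Ш[p^∞] + ord_p Reg_p(Dh) + ord_p ∏c_ℓ`.
[cite: Delbourgo2002, Theorem (A), (B) (p. 40), ℓ_p(E) = 1 (p. 39)] [cite: Washington1997, §7.1] -/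
theorem PotMult.rank_add_le_padicVal_of_charLamLe (hDelM : Delbourgo2002.mainTheorem_potMult)
    (hpm : PotMult W p) (hp2 : p ≠ 2) (hlam : CharLamLeAt W p W.mordellWeilRank)
    {Dh : PAdicHeightData W p} (hB : LeadingTermClauses W p Dh) :
    (W.mordellWeilRank : ℤ) + 2 * padicValNat p W.torsionOrder ≤
      (padicValNat p (Nat.card (AddCommGroup.primaryComponent W.sha p)) : ℤ) +
        (padicRegulator Dh).valuation + padicValNat p W.tamagawaProduct :=
  (Additive.rank_add_le_padicVal_of_charLamLe W p hB (hpm.delbourgo2002 hDelM hp2).1 hp2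
    hpm.reductionNonAnomalous hlam).2

/-- **(M), `r_an ≤ 1`: the per-pair LOWER half from the λ-certificate and ONE regulator valuation.**
`p` odd, `PotMult W p`, GZK (`Ш` finite), `#Ш_an = s`, and for every (B)-datum `Dh` the computed
inequality `ord_p Reg_p(Dh) + ord_p s + ord_p ∏c_ℓ ≤ rank + 2·ord_p #tors` ⟹ `Typed.MissingLowerBoundAt W p`.
[cite: Delbourgo2002, Theorem (A), (B) (p. 40)] [cite: Miller2011LMS, Def. 1.1] -/
theorem PotMult.missingLowerBoundAt_of_charLamLe_of_regulatorCertificate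
    (hDelM : Delbourgo2002.mainTheorem_potMult) (hGZK : rank_eq_analyticRank_of_analyticRank_le_one)
    (hpm : PotMult W p) (hp2 : p ≠ 2) (hr : W.analyticRank ≤ 1)
    (hlam : CharLamLeAt W p W.mordellWeilRank) {s : ℚ} (hs : shaAn W = (s : ℂ))
    (hcert : ∀ Dh : PAdicHeightData W p, LeadingTermClauses W p Dh →
      (padicRegulator Dh).valuation + padicValRat p s + padicValNat p W.tamagawaProduct ≤
        (W.mordellWeilRank : ℤ) + 2 * padicValNat p W.torsionOrder) :
    MissingLowerBoundAt W p := by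
  obtain ⟨hA, Dh, hB⟩ := hpm.delbourgo2002 hDelM hp2
  exact Additive.missingLowerBoundAt_of_charLamLe_of_regulatorCertificate W p hB hA hGZK hr hp2
    hpm.reductionNonAnomalous hlam hs (hcert Dh hB)

/-- **X4(M), `r_an ≤ 1`, any odd `p`: the per-pair LOWER half from the λ-certificate and one regulator
valuation.** [cite: Delbourgo2002, Theorem (A), (B) (p. 40)] [cite: Miller2011LMS, Def. 1.1] -/
theorem ClassX4M.missingLowerBoundAt_of_charLamLe_of_regulatorCertificate
    (hDelM : Delbourgo2002.mainTheorem_potMult) (hGZK : rank_eq_analyticRank_of_analyticRank_le_one)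
    (hX : ClassX4M W p) (hr : W.analyticRank ≤ 1) (hlam : CharLamLeAt W p W.mordellWeilRank)
    {s : ℚ} (hs : shaAn W = (s : ℂ))
    (hcert : ∀ Dh : PAdicHeightData W p, LeadingTermClauses W p Dh →
      (padicRegulator Dh).valuation + padicValRat p s + padicValNat p W.tamagawaProduct ≤
        (W.mordellWeilRank : ℤ) + 2 * padicValNat p W.torsionOrder) :
    MissingLowerBoundAt W p :=
  hX.potMult.missingLowerBoundAt_of_charLamLe_of_regulatorCertificate hDelM hGZK hX.p_ne_two hr hlam hs
    hcert

/-- **X3♯(M), `r_an ≤ 1`, any odd `p` (reducible `E[p]`): the per-pair LOWER half from the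
λ-certificate and one regulator valuation** — no image hypothesis is needed for the lower half.
[cite: Delbourgo2002, Theorem (A), (B) (p. 40)] [cite: Miller2011LMS, Def. 1.1] -/
theorem ClassX3M.missingLowerBoundAt_of_charLamLe_of_regulatorCertificate
    (hDelM : Delbourgo2002.mainTheorem_potMult) (hGZK : rank_eq_analyticRank_of_analyticRank_le_one)
    (hX : ClassX3M W p) (hr : W.analyticRank ≤ 1) (hlam : CharLamLeAt W p W.mordellWeilRank)
    {s : ℚ} (hs : shaAn W = (s : ℂ))
    (hcert : ∀ Dh : PAdicHeightData W p, LeadingTermClauses W p Dh →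
      (padicRegulator Dh).valuation + padicValRat p s + padicValNat p W.tamagawaProduct ≤
        (W.mordellWeilRank : ℤ) + 2 * padicValNat p W.torsionOrder) :
    MissingLowerBoundAt W p :=
  hX.potMult.missingLowerBoundAt_of_charLamLe_of_regulatorCertificate hDelM hGZK hX.p_ne_two hr hlam hs
    hcert

end Summit.BirchSwinnertonDyer.Rank1Residual.AdditivePotMult

namespace Summit.BirchSwinnertonDyer.Rank1Residual.Additive

variable {W : WeierstrassCurve ℚ} [W.IsElliptic] [W.IsGloballyMinimal] {p : ℕ} [hp : Fact p.Prime]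

/-! ### (G)-ordinary, `p ≥ 5`, non-CM (A175) -/

/-- **(G-ord), `p ≥ 5`, non-CM: the λ-certificate gives the Schneider rider for every (B)-datum and
`#Ш(E/ℚ)[p^∞] < ∞`** (Delbourgo 2002 (A)+(B), A175). [cite: Delbourgo2002, Theorem (A), (B) (p. 40)] -/
theorem TypeGOrd.schneider_and_finite_of_charLamLe (hDel : Delbourgo2002.mainTheorem) (hp5 : 5 ≤ p)
    (hcm : ¬ W.HasCM) (hadd : Addv W p) (hG : TypeGOrd W p) (hlam : CharLamLeAt W p W.mordellWeilRank) :
    (∀ Dh : PAdicHeightData W p, LeadingTermClauses W p Dh → SchneiderConjecture Dh) ∧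
      Finite (AddCommGroup.primaryComponent W.sha p) := by
  have hA : ∀ (κ : ZpExtension ℚ p) (γ : Field.absoluteGaloisGroup ℚ),
      κ.IsCyclotomic → κ.IsTopGenerator γ → ∀ D : W.SelmerDualData κ γ, D.IsTorsion :=
    fun κ γ hκ hγ D ↦ hDel.isTorsion hp5 hcm hadd hG hκ hγ D
  obtain ⟨Dh, hB⟩ := hDel.exists_leadingTermClauses hp5 hcm hadd hG
  exact ⟨fun Dh' hB' ↦ (Additive.schneider_and_finite_of_charLamLe W p hB' hA hlam).1,
    (Additive.schneider_and_finite_of_charLamLe W p hB hA hlam).2⟩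

/-- **(G-ord), `p ≥ 5`, non-CM, non-anomalous, `r_an ≤ 1`: the per-pair LOWER half from the
λ-certificate and one regulator valuation.** [cite: Delbourgo2002, Theorem (A), (B) (p. 40)]
[cite: Miller2011LMS, Def. 1.1] -/
theorem TypeGOrd.missingLowerBoundAt_of_charLamLe_of_regulatorCertificate
    (hDel : Delbourgo2002.mainTheorem) (hGZK : rank_eq_analyticRank_of_analyticRank_le_one)
    (hp5 : 5 ≤ p) (hcm : ¬ W.HasCM) (hadd : Addv W p) (hG : TypeGOrd W p) (hr : W.analyticRank ≤ 1)
    (hna : ReductionNonAnomalous W p) (hlam : CharLamLeAt W p W.mordellWeilRank)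
    {s : ℚ} (hs : shaAn W = (s : ℂ))
    (hcert : ∀ Dh : PAdicHeightData W p, LeadingTermClauses W p Dh →
      (padicRegulator Dh).valuation + padicValRat p s + padicValNat p W.tamagawaProduct ≤
        (W.mordellWeilRank : ℤ) + 2 * padicValNat p W.torsionOrder) :
    MissingLowerBoundAt W p := by
  have hp2 : p ≠ 2 := by omega
  have hA : ∀ (κ : ZpExtension ℚ p) (γ : Field.absoluteGaloisGroup ℚ),
      κ.IsCyclotomic → κ.IsTopGenerator γ → ∀ D : W.SelmerDualData κ γ, D.IsTorsion :=
    fun κ γ hκ hγ D ↦ hDel.isTorsion hp5 hcm hadd hG hκ hγ D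
  obtain ⟨Dh, hB⟩ := hDel.exists_leadingTermClauses hp5 hcm hadd hG
  exact Additive.missingLowerBoundAt_of_charLamLe_of_regulatorCertificate W p hB hA hGZK hr hp2 hna
    hlam hs (hcert Dh hB)

end Summit.BirchSwinnertonDyer.Rank1Residual.Additive

end
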